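import Mathlib
import HarnessLib
import Literature.MathematicalPhysics.QuantumLattice.GaugeGroups
import Literature.MathematicalPhysics.QuantumFieldTheory.ConstructiveQFTWave0
import Literature.MathematicalPhysics.QuantumFieldTheory.U1GinibreComparison
import Literature.MathematicalPhysics.QuantumFieldTheory.LatticeGaugeProofs
import Summits.Ventures.LatticeQCDFlow.Scaling.WilsonPatchUpperBound

/-!
# LatticeQCDFlow / Scaling — two dimensions, `U(1)`: ANY two plaquette observables decorrelate as the volume grows, uniformly in their positions

HONEST FRAMING: exact (Metropolis-corrected) sampling algorithms for lattice gauge theory; figures of merit are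
autocorrelation/cost numbers at stated couplings and volumes; no continuum-physics claim.

Venture `LatticeQCDFlow` (cell pub-lqcd), topic `Scaling`, FANOUT row 30 (lean-1) — OUR WORK.  The two-sided pair
comparison of `Scaling/WilsonPatchUpperBound.lean` (`u1_pair_lintegral_le/_ge`: pair expectations of the 2-d `U(1)`
Wilson measure are within `ρ_{L,2}(β)^{±1}` of the product one-plaquette law, `ρ_{L,2}(β) = e^{−β(L²−2)(1−cos(π/(L²−3)))}`)
turned into a REAL-VALUED covariance bound and its limit:

* `abs_sub_mul_le_of_sandwich` — elementary: a multiplicative sandwich with ratio `r ∈ (0,1]` on `X ≈ ab`, `Y ≈ a`,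
  `Z ≈ b` (`0 ≤ a ≤ A`, `0 ≤ b ≤ B`) gives `|X − YZ| ≤ (r⁻² − r)·AB`; `toReal_sandwich_of_mul_le` — `ℝ≥0∞ → ℝ`;
* `u1_abs_cov_plaquette_pair_le_of_nonneg`, **`u1_abs_cov_plaquette_pair_le`** — for `L ≥ 3`, `β ≥ 0`, ALL sites
  `p ≠ p'` of `(ℤ/L)²` and all measurable `φ, ψ : U(1) → ℝ` with `|φ| ≤ A`, `|ψ| ≤ B`:
  `|⟨φ(U_p)ψ(U_{p'})⟩_{β,L} − ⟨φ(U_p)⟩_{β,L}·⟨ψ(U_{p'})⟩_{β,L}| ≤ 4AB·(ρ_{L,2}(β)⁻² − ρ_{L,2}(β))` (`⟨·⟩ = wilsonExpectation`)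
  — the SAME bound for adjacent and for far-apart plaquettes: the plaquette variables of the abelian 2-torus are
  exchangeable (i.i.d. one-plaquette laws conditioned on `∏_x U_x = 1`), the connected correlator is a pure
  finite-volume effect;
* `pairExponent_le` (`(L²−2)(1−cos(π/(L²−3))) ≤ π²/L`, `L ≥ 3`), **`tendsto_u1_pairFactor`** (`ρ_{L,2}(β) → 1`),
  `tendsto_u1_covFactor` (`4(ρ⁻²−ρ) → 0`) as `L → ∞` at fixed `β`;
* **`u1_plaquette_pair_decorrelation`** — packaged: `∃ C_β(L) → 0` with `|Cov_{β,L}(φ(U_p), ψ(U_{p'}))| ≤ A·B·C_β(L)`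
  for every `L ≥ 3`, all `p ≠ p'`, all bounded measurable `φ, ψ`.

The rate `ρ⁻² − ρ = O(β/L²)` is not sharp (the truth is exponentially small in `L²`); only `→ 0` is used downstream
(`Scaling/CorrelatorFloorTwoDimU1.lean`: the venture's volume-law hypotheses (U′)/(U″) are FALSE in `d = 2`).
NOT CLAIMED: `β < 0`; non-abelian `G`.  Literature grade: known (two-dimensional lattice gauge theory is solvable,
plaquettes independent up to the global constraint — Migdal 1975, Gross–Witten 1980); new = the kernel-checked,
volume-uniform covariance bound in the venture's vocabulary.  Elementary given the tree; nothing here is cited as a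
fact; no `def`, no `sorry`.
-/

noncomputable section

namespace Summit.Ventures.LatticeQCDFlow.Theory2.Lattice.TwoDim

open MeasureTheory Filter Topology Literature.MathematicalPhysics.QuantumFieldTheory
open Literature.MathematicalPhysics.QuantumLattice
open Summit.Ventures.LatticeQCDFlow.Theory2.HaarConv
open scoped ENNReal

section U1

variable {L : ℕ}

/-! ## §4. The covariance of two plaquette observables, real-valued -/

/-- Elementary: a two-sided multiplicative sandwich with ratio `r ∈ (0, 1]` on `X ≈ ab`, `Y ≈ a`, `Z ≈ b`
(`0 ≤ a ≤ A`, `0 ≤ b ≤ B`) forces `|X − YZ| ≤ (r⁻² − r)·AB`. [folklore] -/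
theorem abs_sub_mul_le_of_sandwich {r a b A B X Y Z : ℝ} (hr0 : 0 < r) (hr1 : r ≤ 1)
    (ha : 0 ≤ a) (hb : 0 ≤ b) (haA : a ≤ A) (hbB : b ≤ B)
    (hX1 : r * (a * b) ≤ X) (hX2 : X ≤ r⁻¹ * (a * b)) (hY1 : r * a ≤ Y) (hY2 : Y ≤ r⁻¹ * a)
    (hZ1 : r * b ≤ Z) (hZ2 : Z ≤ r⁻¹ * b) :
    |X - Y * Z| ≤ (r⁻¹ ^ 2 - r) * (A * B) := by
  have hc1 : 1 ≤ r⁻¹ := one_le_inv_iff₀.mpr ⟨hr0, hr1⟩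
  have hrc : r * r⁻¹ = 1 := mul_inv_cancel₀ hr0.ne'
  have hY0 : 0 ≤ Y := le_trans (mul_nonneg hr0.le ha) hY1
  have hZ0 : 0 ≤ Z := le_trans (mul_nonneg hr0.le hb) hZ1
  have hab : a * b ≤ A * B := mul_le_mul haA hbB hb (ha.trans haA)
  have hab0 : 0 ≤ a * b := mul_nonneg ha hb
  have hYZup : Y * Z ≤ (r⁻¹ * a) * (r⁻¹ * b) := mul_le_mul hY2 hZ2 hZ0 (by positivity)
  have hYZlo : (r * a) * (r * b) ≤ Y * Z := mul_le_mul hY1 hZ1 (by positivity) hY0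
  -- the coefficient comparisons `r⁻¹ − r² ≤ r⁻² − r` and `r⁻² − r ≥ 0`
  have hcoef0 : 0 ≤ r⁻¹ ^ 2 - r := by nlinarith
  have hcoef1 : r⁻¹ - r ^ 2 ≤ r⁻¹ ^ 2 - r := by nlinarith
  rw [abs_le]
  constructor
  · -- lower: `X − YZ ≥ r ab − r⁻² ab = −(r⁻² − r) ab ≥ −(r⁻² − r) AB`
    have h1 : X - Y * Z ≥ r * (a * b) - (r⁻¹ * a) * (r⁻¹ * b) := by linarith
    have h2 : r * (a * b) - (r⁻¹ * a) * (r⁻¹ * b) = -((r⁻¹ ^ 2 - r) * (a * b)) := by ring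
    have h3 : (r⁻¹ ^ 2 - r) * (a * b) ≤ (r⁻¹ ^ 2 - r) * (A * B) := mul_le_mul_of_nonneg_left hab hcoef0
    linarith
  · -- upper: `X − YZ ≤ r⁻¹ ab − r² ab ≤ (r⁻² − r) ab ≤ (r⁻² − r) AB`
    have h1 : X - Y * Z ≤ r⁻¹ * (a * b) - (r * a) * (r * b) := by linarith
    have h2 : r⁻¹ * (a * b) - (r * a) * (r * b) = (r⁻¹ - r ^ 2) * (a * b) := by ring
    have h3 : (r⁻¹ - r ^ 2) * (a * b) ≤ (r⁻¹ ^ 2 - r) * (a * b) := mul_le_mul_of_nonneg_right hcoef1 hab0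
    have h4 : (r⁻¹ ^ 2 - r) * (a * b) ≤ (r⁻¹ ^ 2 - r) * (A * B) := mul_le_mul_of_nonneg_left hab hcoef0
    linarith

/-- From the `ℝ≥0∞` sandwich `ρ·L ≤ c`, `ρ·c ≤ L` (`ρ ≠ 0, ∞`, `c ≠ ∞`) to the real one:
`ρ·c ≤ L ≤ ρ⁻¹·c` after `toReal`. [folklore] -/
theorem toReal_sandwich_of_mul_le {ρ I c : ℝ≥0∞} (hρ0 : ρ ≠ 0) (hρt : ρ ≠ ⊤) (hct : c ≠ ⊤)
    (h1 : ρ * I ≤ c) (h2 : ρ * c ≤ I) :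
    ρ.toReal * c.toReal ≤ I.toReal ∧ I.toReal ≤ ρ.toReal⁻¹ * c.toReal := by
  have hIle : I ≤ ρ⁻¹ * c := by
    calc I = ρ⁻¹ * ρ * I := by rw [ENNReal.inv_mul_cancel hρ0 hρt, one_mul]
      _ = ρ⁻¹ * (ρ * I) := mul_assoc _ _ _
      _ ≤ ρ⁻¹ * c := by gcongr
  have hIt : I ≠ ⊤ := ne_top_of_le_ne_top (ENNReal.mul_ne_top (ENNReal.inv_ne_top.mpr hρ0) hct) hIle
  refine ⟨?_, ?_⟩
  · have h := ENNReal.toReal_mono hIt h2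
    rwa [ENNReal.toReal_mul] at h
  · have h := ENNReal.toReal_mono (ENNReal.mul_ne_top (ENNReal.inv_ne_top.mpr hρ0) hct) hIle
    rwa [ENNReal.toReal_mul, ENNReal.toReal_inv] at h

/-- **THE COVARIANCE OF A PLAQUETTE PAIR, non-negative bounded observables** (2-d `U(1)`, `L ≥ 3`, `β ≥ 0`,
sites `p ≠ p'`, measurable `0 ≤ φ ≤ A`, `0 ≤ ψ ≤ B`):
`|∫ φ(U_p)ψ(U_{p'}) dμ − ∫ φ(U_p) dμ · ∫ ψ(U_{p'}) dμ| ≤ (ρ⁻² − ρ)·AB`, `ρ = ρ_{L,2}(β)`. [folklore] -/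
theorem u1_abs_cov_plaquette_pair_le_of_nonneg [NeZero L] (hL : 3 ≤ L) {β : ℝ} (hβ : 0 ≤ β)
    {p p' : Site 2 L} (hpp' : p ≠ p') {φ ψ : Circle → ℝ} (hφm : Measurable φ) (hψm : Measurable ψ)
    {A B : ℝ} (hφ0 : ∀ z, 0 ≤ φ z) (hφA : ∀ z, φ z ≤ A) (hψ0 : ∀ z, 0 ≤ ψ z) (hψB : ∀ z, ψ z ≤ B) :
    |(∫ U, φ (plaquetteHolonomy U p 0 1) * ψ (plaquetteHolonomy U p' 0 1)
        ∂(wilsonMeasure (d := 2) (L := L) u1Rep β)) -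
      (∫ U, φ (plaquetteHolonomy U p 0 1) ∂(wilsonMeasure (d := 2) (L := L) u1Rep β)) *
      (∫ U, ψ (plaquetteHolonomy U p' 0 1) ∂(wilsonMeasure (d := 2) (L := L) u1Rep β))| ≤
    ((Real.exp (-(β * (((L ^ 2 - 2 : ℕ) : ℝ) *
        (1 - Real.cos (Real.pi / ((L ^ 2 - 2 - 1 : ℕ) : ℝ)))))))⁻¹ ^ 2 -
      Real.exp (-(β * (((L ^ 2 - 2 : ℕ) : ℝ) *
        (1 - Real.cos (Real.pi / ((L ^ 2 - 2 - 1 : ℕ) : ℝ))))))) * (A * B) := by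
  set μ := wilsonMeasure (d := 2) (L := L) u1Rep β with hμ
  haveI : IsProbabilityMeasure μ :=
    isProbabilityMeasure_wilsonMeasure (d := 2) (L := L) u1Rep continuous_u1Rep β
  -- `ℝ≥0∞` versions of the observables and the six bounds of §3
  set Φ : Circle → ℝ≥0∞ := fun z => ENNReal.ofReal (φ z) with hΦ
  set Ψ : Circle → ℝ≥0∞ := fun z => ENNReal.ofReal (ψ z) with hΨ
  have hΦm : Measurable Φ := hφm.ennreal_ofReal
  have hΨm : Measurable Ψ := hψm.ennreal_ofReal
  have h1m : Measurable fun _ : Circle => (1 : ℝ≥0∞) := measurable_const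
  have hX := u1_pair_lintegral_le hL hβ hpp' hΦm hΨm
  have hX' := u1_pair_lintegral_ge hL hβ hpp' hΦm hΨm
  have hY := u1_pair_lintegral_le hL hβ hpp' hΦm h1m
  have hY' := u1_pair_lintegral_ge hL hβ hpp' hΦm h1m
  have hZ := u1_pair_lintegral_le hL hβ hpp' h1m hΨm
  have hZ' := u1_pair_lintegral_ge hL hβ hpp' h1m hΨm
  simp only [mul_one, one_mul, lintegral_u1W_div hβ] at hY hY' hZ hZ'
  -- the factor
  set e : ℝ := β * (((L ^ 2 - 2 : ℕ) : ℝ) * (1 - Real.cos (Real.pi / ((L ^ 2 - 2 - 1 : ℕ) : ℝ)))) with he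
  set ρ : ℝ≥0∞ := ENNReal.ofReal (Real.exp (-e)) with hρ
  have he0 : 0 ≤ e := mul_nonneg hβ (mul_nonneg (Nat.cast_nonneg _)
    (by linarith [Real.cos_le_one (Real.pi / ((L ^ 2 - 2 - 1 : ℕ) : ℝ))]))
  have hr0 : 0 < Real.exp (-e) := Real.exp_pos _
  have hr1 : Real.exp (-e) ≤ 1 := Real.exp_le_one_iff.mpr (neg_nonpos.mpr he0)
  have hρ0 : ρ ≠ 0 := (ENNReal.ofReal_pos.mpr hr0).ne'
  have hρt : ρ ≠ ⊤ := ENNReal.ofReal_ne_top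
  have hρr : ρ.toReal = Real.exp (-e) := ENNReal.toReal_ofReal hr0.le
  -- the product-law means are finite and bounded by `A`, `B`
  set z := z1 u1Rep β with hz
  have hz0 : z ≠ 0 := z1_u1_ne_zero β
  have hzt : z ≠ ⊤ := ne_top_of_le_ne_top ENNReal.one_ne_top (z1_u1_le_one hβ)
  set a := (∫⁻ u, Φ u * u1W β u ∂(haarProbability Circle)) / z with ha
  set b := (∫⁻ u, Ψ u * u1W β u ∂(haarProbability Circle)) / z with hb
  have hA0 : 0 ≤ A := (hφ0 1).trans (hφA 1)
  have hB0 : 0 ≤ B := (hψ0 1).trans (hψB 1)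
  have haA : a ≤ ENNReal.ofReal A := by
    rw [ha, ENNReal.div_le_iff hz0 hzt]
    calc ∫⁻ u, Φ u * u1W β u ∂(haarProbability Circle)
        ≤ ∫⁻ u, ENNReal.ofReal A * u1W β u ∂(haarProbability Circle) :=
          lintegral_mono fun u => mul_le_mul_left (ENNReal.ofReal_le_ofReal (hφA u)) _
      _ = ENNReal.ofReal A * z := by rw [lintegral_const_mul _ (measurable_u1W β), hz, z1_eq_lintegral_u1W]
  have hbB : b ≤ ENNReal.ofReal B := by
    rw [hb, ENNReal.div_le_iff hz0 hzt]
    calc ∫⁻ u, Ψ u * u1W β u ∂(haarProbability Circle)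
        ≤ ∫⁻ u, ENNReal.ofReal B * u1W β u ∂(haarProbability Circle) :=
          lintegral_mono fun u => mul_le_mul_left (ENNReal.ofReal_le_ofReal (hψB u)) _
      _ = ENNReal.ofReal B * z := by rw [lintegral_const_mul _ (measurable_u1W β), hz, z1_eq_lintegral_u1W]
  have hat : a ≠ ⊤ := ne_top_of_le_ne_top ENNReal.ofReal_ne_top haA
  have hbt : b ≠ ⊤ := ne_top_of_le_ne_top ENNReal.ofReal_ne_top hbB
  have har : a.toReal ≤ A := (ENNReal.toReal_mono ENNReal.ofReal_ne_top haA).trans_eq (ENNReal.toReal_ofReal hA0)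
  have hbr : b.toReal ≤ B := (ENNReal.toReal_mono ENNReal.ofReal_ne_top hbB).trans_eq (ENNReal.toReal_ofReal hB0)
  -- real sandwiches
  obtain ⟨hX1, hX2⟩ := toReal_sandwich_of_mul_le hρ0 hρt (ENNReal.mul_ne_top hat hbt) hX hX'
  obtain ⟨hY1, hY2⟩ := toReal_sandwich_of_mul_le hρ0 hρt hat hY hY'
  obtain ⟨hZ1, hZ2⟩ := toReal_sandwich_of_mul_le hρ0 hρt hbt hZ hZ'
  rw [ENNReal.toReal_mul, hρr] at hX1 hX2
  rw [hρr] at hY1 hY2 hZ1 hZ2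
  -- the three real integrals are the `toReal`s
  have hmp : ∀ q : Site 2 L, Measurable fun U : GaugeConfig 2 L Circle => plaquetteHolonomy U q 0 1 :=
    fun q => measurable_plaquetteHolonomy q
  have hIX : ∫ U, φ (plaquetteHolonomy U p 0 1) * ψ (plaquetteHolonomy U p' 0 1) ∂μ =
      (∫⁻ U, Φ (plaquetteHolonomy U p 0 1) * Ψ (plaquetteHolonomy U p' 0 1) ∂μ).toReal := by
    rw [integral_eq_lintegral_of_nonneg_ae (ae_of_all _ fun U => mul_nonneg (hφ0 _) (hψ0 _))
      (((hφm.comp (hmp p)).mul (hψm.comp (hmp p'))).aestronglyMeasurable)]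
    congr 1
    exact lintegral_congr fun U => by rw [hΦ, hΨ, ENNReal.ofReal_mul (hφ0 _)]
  have hIY : ∫ U, φ (plaquetteHolonomy U p 0 1) ∂μ = (∫⁻ U, Φ (plaquetteHolonomy U p 0 1) ∂μ).toReal :=
    integral_eq_lintegral_of_nonneg_ae (ae_of_all _ fun U => hφ0 _) ((hφm.comp (hmp p)).aestronglyMeasurable)
  have hIZ : ∫ U, ψ (plaquetteHolonomy U p' 0 1) ∂μ = (∫⁻ U, Ψ (plaquetteHolonomy U p' 0 1) ∂μ).toReal :=
    integral_eq_lintegral_of_nonneg_ae (ae_of_all _ fun U => hψ0 _) ((hψm.comp (hmp p')).aestronglyMeasurable)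
  rw [hIX, hIY, hIZ]
  exact abs_sub_mul_le_of_sandwich hr0 hr1 ENNReal.toReal_nonneg ENNReal.toReal_nonneg har hbr
    hX1 hX2 hY1 hY2 hZ1 hZ2

/-- **THE COVARIANCE OF A PLAQUETTE PAIR** (2-d `U(1)`, `L ≥ 3`, `β ≥ 0`): for ALL sites `p ≠ p'` of `(ℤ/L)²`
and all bounded measurable `φ, ψ : U(1) → ℝ` (`|φ| ≤ A`, `|ψ| ≤ B`),
`|⟨φ(U_p)ψ(U_{p'})⟩_{β,L} − ⟨φ(U_p)⟩_{β,L}·⟨ψ(U_{p'})⟩_{β,L}| ≤ 4AB·(ρ_{L,2}(β)⁻² − ρ_{L,2}(β))`,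
`ρ_{L,2}(β) = e^{−β(L²−2)(1−cos(π/(L²−3)))}` — the same bound for adjacent and for far-apart plaquettes. [folklore] -/
theorem u1_abs_cov_plaquette_pair_le [NeZero L] (hL : 3 ≤ L) {β : ℝ} (hβ : 0 ≤ β)
    {p p' : Site 2 L} (hpp' : p ≠ p') {φ ψ : Circle → ℝ} (hφm : Measurable φ) (hψm : Measurable ψ)
    {A B : ℝ} (hφA : ∀ z, |φ z| ≤ A) (hψB : ∀ z, |ψ z| ≤ B) :
    |wilsonExpectation (d := 2) (L := L) u1Rep β
          (fun U => φ (plaquetteHolonomy U p 0 1) * ψ (plaquetteHolonomy U p' 0 1)) -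
      wilsonExpectation (d := 2) (L := L) u1Rep β (fun U => φ (plaquetteHolonomy U p 0 1)) *
        wilsonExpectation (d := 2) (L := L) u1Rep β (fun U => ψ (plaquetteHolonomy U p' 0 1))| ≤
    4 * (A * B) * ((Real.exp (-(β * (((L ^ 2 - 2 : ℕ) : ℝ) *
        (1 - Real.cos (Real.pi / ((L ^ 2 - 2 - 1 : ℕ) : ℝ)))))))⁻¹ ^ 2 -
      Real.exp (-(β * (((L ^ 2 - 2 : ℕ) : ℝ) *
        (1 - Real.cos (Real.pi / ((L ^ 2 - 2 - 1 : ℕ) : ℝ))))))) := by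
  unfold wilsonExpectation
  set μ := wilsonMeasure (d := 2) (L := L) u1Rep β with hμ
  haveI : IsProbabilityMeasure μ :=
    isProbabilityMeasure_wilsonMeasure (d := 2) (L := L) u1Rep continuous_u1Rep β
  have hA0 : 0 ≤ A := (abs_nonneg _).trans (hφA 1)
  have hB0 : 0 ≤ B := (abs_nonneg _).trans (hψB 1)
  -- shifted, non-negative observables
  have hmp : ∀ q : Site 2 L, Measurable fun U : GaugeConfig 2 L Circle => plaquetteHolonomy U q 0 1 :=
    fun q => measurable_plaquetteHolonomy q
  have key := u1_abs_cov_plaquette_pair_le_of_nonneg hL hβ hpp' (φ := fun z => φ z + A)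
    (ψ := fun z => ψ z + B) (hφm.add_const A) (hψm.add_const B) (A := 2 * A) (B := 2 * B)
    (fun z => by linarith [neg_abs_le (φ z), hφA z]) (fun z => by linarith [le_abs_self (φ z), hφA z])
    (fun z => by linarith [neg_abs_le (ψ z), hψB z]) (fun z => by linarith [le_abs_self (ψ z), hψB z])
  -- integrability of the bounded observables
  set F : GaugeConfig 2 L Circle → ℝ := fun U => φ (plaquetteHolonomy U p 0 1) with hF
  set G : GaugeConfig 2 L Circle → ℝ := fun U => ψ (plaquetteHolonomy U p' 0 1) with hG
  have hFm : Measurable F := hφm.comp (hmp p)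
  have hGm : Measurable G := hψm.comp (hmp p')
  have hFi : Integrable F μ := Integrable.of_bound hFm.aestronglyMeasurable A
    (ae_of_all _ fun U => by rw [Real.norm_eq_abs]; exact hφA _)
  have hGi : Integrable G μ := Integrable.of_bound hGm.aestronglyMeasurable B
    (ae_of_all _ fun U => by rw [Real.norm_eq_abs]; exact hψB _)
  have hFGi : Integrable (fun U => F U * G U) μ := Integrable.of_bound (hFm.mul hGm).aestronglyMeasurable (A * B)
    (ae_of_all _ fun U => by
      rw [Real.norm_eq_abs, abs_mul]
      exact mul_le_mul (hφA _) (hψB _) (abs_nonneg _) hA0)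
  -- the shifted covariance equals the covariance
  have hXe : ∫ U, (φ (plaquetteHolonomy U p 0 1) + A) * (ψ (plaquetteHolonomy U p' 0 1) + B) ∂μ =
      ∫ U, F U * G U ∂μ + B * ∫ U, F U ∂μ + A * ∫ U, G U ∂μ + A * B := by
    have h1 : (fun U => (φ (plaquetteHolonomy U p 0 1) + A) * (ψ (plaquetteHolonomy U p' 0 1) + B)) =
        fun U => F U * G U + B * F U + A * G U + A * B := by
      funext U; simp only [hF, hG]; ring
    have i1 : Integrable (fun U => F U * G U + B * F U) μ := hFGi.add (hFi.const_mul B)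
    have i2 : Integrable (fun U => F U * G U + B * F U + A * G U) μ := i1.add (hGi.const_mul A)
    rw [h1, integral_add i2 (integrable_const _), integral_add i1 (hGi.const_mul A),
      integral_add hFGi (hFi.const_mul B), integral_const_mul, integral_const_mul, integral_const]
    simp
  have hYe : ∫ U, (φ (plaquetteHolonomy U p 0 1) + A) ∂μ = ∫ U, F U ∂μ + A := by
    rw [integral_add hFi (integrable_const _), integral_const]; simp
  have hZe : ∫ U, (ψ (plaquetteHolonomy U p' 0 1) + B) ∂μ = ∫ U, G U ∂μ + B := by
    rw [integral_add hGi (integrable_const _), integral_const]; simp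
  rw [hXe, hYe, hZe] at key
  have hcov : ∫ U, F U * G U ∂μ + B * ∫ U, F U ∂μ + A * ∫ U, G U ∂μ + A * B -
      (∫ U, F U ∂μ + A) * (∫ U, G U ∂μ + B) = ∫ U, F U * G U ∂μ - (∫ U, F U ∂μ) * ∫ U, G U ∂μ := by ring
  rw [hcov] at key
  calc _ ≤ _ := key
    _ = _ := by ring

/-! ## §5. The decorrelation factor tends to one -/

/-- The exponent of `ρ_{L,2}(β)`: for `L ≥ 3`, `(L²−2)(1−cos(π/(L²−3))) ≤ π²/L` (from `1 − cos x ≤ x²/2`). [folklore] -/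
theorem pairExponent_le {L : ℕ} (hL : 3 ≤ L) :
    ((L ^ 2 - 2 : ℕ) : ℝ) * (1 - Real.cos (Real.pi / ((L ^ 2 - 2 - 1 : ℕ) : ℝ))) ≤ Real.pi ^ 2 / L := by
  obtain ⟨N, hN⟩ : ∃ N, L ^ 2 = N := ⟨_, rfl⟩
  have hN9 : 9 ≤ N := by rw [← hN]; nlinarith
  have hNL : L + 3 ≤ N := by rw [← hN]; nlinarith
  rw [hN]
  set m : ℕ := N - 2 - 1 with hm
  have hm1 : (1 : ℝ) ≤ m := by rw [hm]; exact_mod_cast (show 1 ≤ N - 2 - 1 by omega)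
  have hm0 : (0 : ℝ) < m := by linarith
  have hmL : (L : ℝ) ≤ m := by rw [hm]; exact_mod_cast (show L ≤ N - 2 - 1 by omega)
  have hL0 : (0 : ℝ) < L := by exact_mod_cast (show 0 < L by omega)
  have h1 : ((N - 2 : ℕ) : ℝ) = m + 1 := by
    rw [hm, show N - 2 = (N - 2 - 1) + 1 by omega]; push_cast; ring
  have hcos : 1 - Real.cos (Real.pi / m) ≤ (Real.pi / m) ^ 2 / 2 := by
    linarith [Real.one_sub_sq_div_two_le_cos (x := Real.pi / m)]
  rw [h1]
  calc ((m : ℝ) + 1) * (1 - Real.cos (Real.pi / m)) ≤ ((m : ℝ) + 1) * ((Real.pi / m) ^ 2 / 2) :=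
        mul_le_mul_of_nonneg_left hcos (by positivity)
    _ ≤ Real.pi ^ 2 / m := by
        have key : Real.pi ^ 2 / m - ((m : ℝ) + 1) * ((Real.pi / m) ^ 2 / 2) =
            Real.pi ^ 2 * ((m : ℝ) - 1) / (2 * (m : ℝ) ^ 2) := by
          field_simp
          ring
        have hnn : 0 ≤ Real.pi ^ 2 * ((m : ℝ) - 1) / (2 * (m : ℝ) ^ 2) := by
          apply div_nonneg (mul_nonneg (sq_nonneg _) (by linarith)) (by positivity)
        linarith
    _ ≤ Real.pi ^ 2 / L := div_le_div_of_nonneg_left (sq_nonneg _) hL0 hmL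

/-- **`ρ_{L,2}(β) → 1`** as `L → ∞` at fixed `β`. [folklore] -/
theorem tendsto_u1_pairFactor (β : ℝ) :
    Tendsto (fun L : ℕ => Real.exp (-(β * (((L ^ 2 - 2 : ℕ) : ℝ) *
        (1 - Real.cos (Real.pi / ((L ^ 2 - 2 - 1 : ℕ) : ℝ))))))) atTop (𝓝 1) := by
  have hg : Tendsto (fun L : ℕ => ((L ^ 2 - 2 : ℕ) : ℝ) *
      (1 - Real.cos (Real.pi / ((L ^ 2 - 2 - 1 : ℕ) : ℝ)))) atTop (𝓝 0) := by
    refine tendsto_of_tendsto_of_tendsto_of_le_of_le' tendsto_const_nhds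
      (tendsto_const_div_atTop_nhds_zero_nat (Real.pi ^ 2)) (Eventually.of_forall fun L => ?_) ?_
    · exact mul_nonneg (Nat.cast_nonneg _) (by linarith [Real.cos_le_one (Real.pi / ((L ^ 2 - 2 - 1 : ℕ) : ℝ))])
    · exact Filter.eventually_atTop.2 ⟨3, fun L hL => pairExponent_le hL⟩
  have he : Tendsto (fun L : ℕ => -(β * (((L ^ 2 - 2 : ℕ) : ℝ) *
      (1 - Real.cos (Real.pi / ((L ^ 2 - 2 - 1 : ℕ) : ℝ)))))) atTop (𝓝 (-(β * 0))) :=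
    (hg.const_mul β).neg
  rw [mul_zero, neg_zero] at he
  have h := (Real.continuous_exp.tendsto 0).comp he
  rwa [Real.exp_zero] at h

/-- Hence the covariance factor `4(ρ⁻² − ρ) → 0`. [folklore] -/
theorem tendsto_u1_covFactor (β : ℝ) :
    Tendsto (fun L : ℕ => 4 * ((Real.exp (-(β * (((L ^ 2 - 2 : ℕ) : ℝ) *
        (1 - Real.cos (Real.pi / ((L ^ 2 - 2 - 1 : ℕ) : ℝ)))))))⁻¹ ^ 2 -
      Real.exp (-(β * (((L ^ 2 - 2 : ℕ) : ℝ) *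
        (1 - Real.cos (Real.pi / ((L ^ 2 - 2 - 1 : ℕ) : ℝ)))))))) atTop (𝓝 0) := by
  have h := tendsto_u1_pairFactor β
  have h2 : Tendsto (fun L : ℕ => 4 * ((Real.exp (-(β * (((L ^ 2 - 2 : ℕ) : ℝ) *
        (1 - Real.cos (Real.pi / ((L ^ 2 - 2 - 1 : ℕ) : ℝ)))))))⁻¹ ^ 2 -
      Real.exp (-(β * (((L ^ 2 - 2 : ℕ) : ℝ) *
        (1 - Real.cos (Real.pi / ((L ^ 2 - 2 - 1 : ℕ) : ℝ)))))))) atTop (𝓝 (4 * ((1 : ℝ)⁻¹ ^ 2 - 1))) :=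
    (((h.inv₀ one_ne_zero).pow 2).sub h).const_mul 4
  simpa using h2

/-- **UNIFORM DECORRELATION OF PLAQUETTE PAIRS** (packaged): at every `β ≥ 0` there is `C_β(L) → 0` with
`|⟨φ(U_p)ψ(U_{p'})⟩_{β,L} − ⟨φ(U_p)⟩_{β,L}⟨ψ(U_{p'})⟩_{β,L}| ≤ A·B·C_β(L)` for every `L ≥ 3`, ALL sites `p ≠ p'` of
`(ℤ/L)²` and all measurable `|φ| ≤ A`, `|ψ| ≤ B` — two-dimensional `U(1)` plaquettes are asymptotically independent,
uniformly in their positions. [folklore] -/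
theorem u1_plaquette_pair_decorrelation {β : ℝ} (hβ : 0 ≤ β) :
    ∃ C : ℕ → ℝ, Tendsto C atTop (𝓝 0) ∧
      ∀ (L : ℕ) [NeZero L], 3 ≤ L → ∀ p p' : Site 2 L, p ≠ p' →
        ∀ φ ψ : Circle → ℝ, Measurable φ → Measurable ψ → ∀ A B : ℝ,
          (∀ z, |φ z| ≤ A) → (∀ z, |ψ z| ≤ B) →
          |wilsonExpectation (d := 2) (L := L) u1Rep β
                (fun U => φ (plaquetteHolonomy U p 0 1) * ψ (plaquetteHolonomy U p' 0 1)) -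
            wilsonExpectation (d := 2) (L := L) u1Rep β (fun U => φ (plaquetteHolonomy U p 0 1)) *
              wilsonExpectation (d := 2) (L := L) u1Rep β (fun U => ψ (plaquetteHolonomy U p' 0 1))| ≤
            A * B * C L :=
  ⟨_, tendsto_u1_covFactor β, fun L _ hL p p' hpp' φ ψ hφm hψm A B hφA hψB => by
    calc _ ≤ _ := u1_abs_cov_plaquette_pair_le hL hβ hpp' hφm hψm hφA hψB
      _ = _ := by ring⟩

end U1

end Summit.Ventures.LatticeQCDFlow.Theory2.Lattice.TwoDim

end
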